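import Mathlib
import HarnessLib
import HarnessLib.Audit
import Summits.ValiantsHypothesis.ValiantsHypothesis.Theorems.LacunarySymmetroidMatrixDescartesZeroChangeConcavityBudgetPureT5
import Summits.ValiantsHypothesis.ValiantsHypothesis.Theorems.LacunarySymmetroidMatrixDescartesZeroChangeConcavityBudgetDipPosition

/-!
# ValiantsHypothesis / LacunarySymmetroid — crux `MatrixDescartes` (stmt-ValiantsHypothesis-18050, V1), LINE (A) «product_plus_one»:
# THE DIP TRAIN OF A WINDOW IS SHORT — pull bounds at a dip and the monotone pull `B/t^a`

Tenth part of the concavity budget (✓ `…DipPosition`: dips are early, `a·m < (c−a)·#U`).  Pure `(+,−,−)` company, `0 < a < c`, `m ≥ 1`;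
at `t > 0` off the roots write `U(t) = {j : g_j(t) > 0}` (unswitched rows), `S(t)` the rest, `φ_j = t g_j′/g_j`, and
`B(t) = Σ_{U} (−φ_j)` the unswitched PULL (`= Σ_S φ_j` at a critical point).

* `pureT5_dip_pull_bounds` — at a dip `t`: `S ≠ ∅`, `a·#S < B(t)` and `m·B(t) ≤ (c−a)·#S·#U` (the two Cauchy–Schwarz sides of the dip
  inequality, exported; ★ `pureT5_dip_early` is their quotient);
* `pureT5_pull_mul_pow_le` — the pull per `t^a` increases: for `0 < z₁ ≤ z₂` with the same unswitched set, `B(z₁)·z₂^a ≤ B(z₂)·z₁^a`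
  (row by row: `(a|a₁| + c|a₂|t^{c−a})/g(t)` has increasing numerator and decreasing positive denominator);
* ★ `pureT5_dip_train_short` — for a critical point `z₁` and a dip `z₂ ≥ z₁` with no root on `[z₁, z₂]`:
  `a·m·z₂^a < (c−a)·#U·z₁^a`.  So the whole bad block of a window (which starts at its first critical point, ✓ `pureT5_bad_after_bad`)
  carries its dips within the factor `((c−a)·#U/(a·m))^{1/a} < ((c−a)/a)^{1/a}` of the first critical point: in `s = log t` the dip train
  of a window is shorter than `(1/a)·log((c−a)/a)`, uniformly in `m` and in the window.

HONEST FRAMING: a LOCALISATION (length of the dip train), not a count; def-free, no named facts, no sorry, standard axioms; closes NO stub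
by name; `OneChangeFloorK3`, `MatrixDescartes` (stmt-ValiantsHypothesis-18050) OPEN; `VP ≠ VNP` is NOT proved and nothing here bears on it.

[folklore] Elementary real analysis (Cauchy–Schwarz) and counting; no citation needed.
-/

set_option linter.dupNamespace false

namespace Summit.ValiantsHypothesis.ValiantsHypothesis.Theorems.LacunarySymmetroidMatrixDescartes

namespace ZeroChange

open Polynomial Finset

/-! ## Pull bounds at a dip -/

/-- **Pull bounds at a dip** (pure `(+,−,−)` company, `m ≥ 1`, `0 < a < c`): at a dip `t`, the switched set `S(t)` is nonempty and the
unswitched pull `B(t) = Σ_{U(t)} (−t g_j′/g_j)` satisfies `a·#S < B(t)` and `m·B(t) ≤ (c−a)·#S·#U`. -/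
theorem pureT5_dip_pull_bounds (m a c : ℕ) (hm : 0 < m) (ha : 0 < a) (hac : a < c) (co : Fin m → ℝ × ℝ × ℝ)
    (hT5 : ∀ j, 0 < (co j).1 ∧ (co j).2.1 ≤ 0 ∧ (co j).2.2 ≤ 0 ∧ ((co j).2.1 < 0 ∨ (co j).2.2 < 0))
    {t : ℝ} (ht : 0 < t)
    (hΦ : (∏ j, row a c (co j).1 (co j).2.1 (co j).2.2).eval t ≠ 0)
    (hcrit : (derivative (∏ j, row a c (co j).1 (co j).2.1 (co j).2.2)).eval t = 0)
    (hdip : 0 ≤ (∏ j, row a c (co j).1 (co j).2.1 (co j).2.2).eval t *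
      (derivative (derivative (∏ j, row a c (co j).1 (co j).2.1 (co j).2.2))).eval t) :
    0 < (univ.filter (fun j => ¬ 0 < (row a c (co j).1 (co j).2.1 (co j).2.2).eval t)).card ∧
    (a : ℝ) * (univ.filter (fun j => ¬ 0 < (row a c (co j).1 (co j).2.1 (co j).2.2).eval t)).card <
      ∑ j ∈ univ.filter (fun j => 0 < (row a c (co j).1 (co j).2.1 (co j).2.2).eval t),
        -(t * (derivative (row a c (co j).1 (co j).2.1 (co j).2.2)).eval t / (row a c (co j).1 (co j).2.1 (co j).2.2).eval t) ∧
    (m : ℝ) * ∑ j ∈ univ.filter (fun j => 0 < (row a c (co j).1 (co j).2.1 (co j).2.2).eval t),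
        -(t * (derivative (row a c (co j).1 (co j).2.1 (co j).2.2)).eval t / (row a c (co j).1 (co j).2.1 (co j).2.2).eval t) ≤
      (univ.filter (fun j => ¬ 0 < (row a c (co j).1 (co j).2.1 (co j).2.2).eval t)).card *
        (univ.filter (fun j => 0 < (row a c (co j).1 (co j).2.1 (co j).2.2).eval t)).card * ((c : ℝ) - a) := by
  have ha' : (0 : ℝ) < a := by exact_mod_cast ha
  have hc' : (0 : ℝ) < c := by exact_mod_cast (ha.trans hac)
  have hca : (0 : ℝ) < (c : ℝ) - a := by
    have : (a : ℝ) < c := by exact_mod_cast hac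
    linarith
  have hta : 0 < t ^ a := pow_pos ht a
  have htc : 0 < t ^ c := pow_pos ht c
  have hgt : ∀ j, (row a c (co j).1 (co j).2.1 (co j).2.2).eval t ≠ 0 := by
    intro j h0
    apply hΦ
    rw [eval_prod]
    exact prod_eq_zero (mem_univ j) h0
  -- the logarithmic derivatives `φ_j = t g_j′(t)/g_j(t) = (a a_{j1} t^a + c a_{j2} t^c)/g_j(t)`
  set φ : Fin m → ℝ := fun j => t * (derivative (row a c (co j).1 (co j).2.1 (co j).2.2)).eval t /
    (row a c (co j).1 (co j).2.1 (co j).2.2).eval t with hφ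
  have hφj : ∀ j, φ j = ((a : ℝ) * (co j).2.1 * t ^ a + (c : ℝ) * (co j).2.2 * t ^ c) /
      (row a c (co j).1 (co j).2.1 (co j).2.2).eval t := by
    intro j
    simp only [hφ]
    rw [mul_eval_derivative_row]
  -- (F1) criticality: `Σ_j φ_j = 0`
  have hsum0 : ∑ j, φ j = 0 := by
    have h := eval_derivative_prod_rows m a c co hgt
    rw [hcrit] at h
    have hS : ∑ j, (derivative (row a c (co j).1 (co j).2.1 (co j).2.2)).eval t /
        (row a c (co j).1 (co j).2.1 (co j).2.2).eval t = 0 := (mul_eq_zero.1 h.symm).resolve_left hΦ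
    have e : ∑ j, φ j = t * ∑ j, (derivative (row a c (co j).1 (co j).2.1 (co j).2.2)).eval t /
        (row a c (co j).1 (co j).2.1 (co j).2.2).eval t := by
      rw [mul_sum]
      refine sum_congr rfl fun j _ => ?_
      simp only [hφ]
      ring
    rw [e, hS, mul_zero]
  -- (F2) the dip inequality
  have hdipineq : ∑ j, φ j ^ 2 ≤ (a : ℝ) * ((a : ℝ) - c) * middleSum a c co t :=
    sum_sq_logDeriv_le_of_dip m a c co ht hΦ hcrit hdip
  -- splittings along `p j := 0 < g_j(t)` (stated before naming the two halves `U`, `S`)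
  have hcard0 := card_filter_add_card_filter_not (s := (univ : Finset (Fin m)))
    (fun j => 0 < (row a c (co j).1 (co j).2.1 (co j).2.2).eval t)
  rw [card_univ, Fintype.card_fin] at hcard0
  have hsplitφ : ∑ j ∈ univ.filter (fun j => 0 < (row a c (co j).1 (co j).2.1 (co j).2.2).eval t), φ j +
      ∑ j ∈ univ.filter (fun j => ¬ 0 < (row a c (co j).1 (co j).2.1 (co j).2.2).eval t), φ j = ∑ j, φ j :=
    sum_filter_add_sum_filter_not _ _ _
  have hsplit2 : ∑ j ∈ univ.filter (fun j => 0 < (row a c (co j).1 (co j).2.1 (co j).2.2).eval t), φ j ^ 2 +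
      ∑ j ∈ univ.filter (fun j => ¬ 0 < (row a c (co j).1 (co j).2.1 (co j).2.2).eval t), φ j ^ 2 = ∑ j, φ j ^ 2 :=
    sum_filter_add_sum_filter_not _ _ _
  have hMsplit : ∑ j ∈ univ.filter (fun j => 0 < (row a c (co j).1 (co j).2.1 (co j).2.2).eval t),
        (co j).2.1 * t ^ a / (row a c (co j).1 (co j).2.1 (co j).2.2).eval t +
      ∑ j ∈ univ.filter (fun j => ¬ 0 < (row a c (co j).1 (co j).2.1 (co j).2.2).eval t),
        (co j).2.1 * t ^ a / (row a c (co j).1 (co j).2.1 (co j).2.2).eval t = middleSum a c co t := by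
    rw [middleSum]
    exact sum_filter_add_sum_filter_not _ _ _
  -- unswitched rows `U` (`g_j(t) > 0`) and switched rows `S` (`g_j(t) < 0`)
  set U := univ.filter (fun j => 0 < (row a c (co j).1 (co j).2.1 (co j).2.2).eval t) with hU
  set S := univ.filter (fun j => ¬ 0 < (row a c (co j).1 (co j).2.1 (co j).2.2).eval t) with hS
  have hmemU : ∀ j, j ∈ U ↔ 0 < (row a c (co j).1 (co j).2.1 (co j).2.2).eval t := by
    intro j
    rw [hU, mem_filter]
    simp
  have hmemS : ∀ j, j ∈ S ↔ (row a c (co j).1 (co j).2.1 (co j).2.2).eval t < 0 := by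
    intro j
    rw [hS, mem_filter]
    simp only [mem_univ, true_and, not_lt]
    exact ⟨fun h => lt_of_le_of_ne h (hgt j), fun h => h.le⟩
  have hcardSU : (S.card : ℝ) + U.card = m := by
    have h' : ((U.card + S.card : ℕ) : ℝ) = m := by exact_mod_cast hcard0
    push_cast at h'
    linarith
  -- (F5) switched rows: `φ_j > a`
  have hSgt : ∀ j ∈ S, (a : ℝ) < φ j := by
    intro j hj
    have hg : (row a c (co j).1 (co j).2.1 (co j).2.2).eval t < 0 := (hmemS j).1 hj
    obtain ⟨hp, -, hs, -⟩ := hT5 j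
    have hγ : (co j).2.2 * t ^ c ≤ 0 := mul_nonpos_iff.2 (Or.inr ⟨hs, htc.le⟩)
    rw [hφj j, lt_div_iff_of_neg hg, eval_row]
    nlinarith [mul_nonpos_iff.2 (Or.inl ⟨hca.le, hγ⟩), mul_pos ha' hp]
  -- (F4) unswitched rows: `−φ_j ≥ a·|a_{j1}|t^a/g_j ≥ 0`, and `−φ_j > 0`
  have hUge : ∀ j ∈ U, (a : ℝ) * (-(co j).2.1 * t ^ a / (row a c (co j).1 (co j).2.1 (co j).2.2).eval t) ≤ -φ j := by
    intro j hj
    have hg : 0 < (row a c (co j).1 (co j).2.1 (co j).2.2).eval t := (hmemU j).1 hj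
    obtain ⟨-, -, hs, -⟩ := hT5 j
    have hγ : (co j).2.2 * t ^ c ≤ 0 := mul_nonpos_iff.2 (Or.inr ⟨hs, htc.le⟩)
    rw [hφj j, ← mul_div_assoc, ← neg_div, div_le_div_iff_of_pos_right hg]
    nlinarith [mul_nonpos_iff.2 (Or.inl ⟨hc'.le, hγ⟩)]
  have hUpos : ∀ j ∈ U, 0 < -φ j := by
    intro j hj
    have hg : 0 < (row a c (co j).1 (co j).2.1 (co j).2.2).eval t := (hmemU j).1 hj
    obtain ⟨-, hq, hs, hqs⟩ := hT5 j
    rw [hφj j, ← neg_div]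
    refine div_pos ?_ hg
    rcases hqs with hq' | hs'
    · nlinarith [mul_nonpos_iff.2 (Or.inl ⟨hc'.le, mul_nonpos_iff.2 (Or.inr ⟨hs, htc.le⟩)⟩),
        mul_neg_of_pos_of_neg ha' (mul_neg_of_neg_of_pos hq' hta)]
    · nlinarith [mul_nonpos_iff.2 (Or.inl ⟨ha'.le, mul_nonpos_iff.2 (Or.inr ⟨hq, hta.le⟩)⟩),
        mul_neg_of_pos_of_neg hc' (mul_neg_of_neg_of_pos hs' htc)]
  -- the common value `P = Σ_U (−φ_j) = Σ_S φ_j`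
  set P := ∑ j ∈ U, -φ j with hP
  have hSsum : ∑ j ∈ S, φ j = P := by
    rw [hP, sum_neg_distrib]
    linarith [hsum0]
  have hUsum : ∑ j ∈ U, φ j = -P := by
    rw [hP, sum_neg_distrib, neg_neg]
  -- (F3) `a(a−c)·M ≤ (c−a)·P`
  have hXU : (a : ℝ) * ((a : ℝ) - c) * middleSum a c co t ≤ ((c : ℝ) - a) * P := by
    have hSnn : 0 ≤ ∑ j ∈ S, (co j).2.1 * t ^ a / (row a c (co j).1 (co j).2.1 (co j).2.2).eval t := by
      refine sum_nonneg fun j hj => ?_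
      have hg : (row a c (co j).1 (co j).2.1 (co j).2.2).eval t < 0 := (hmemS j).1 hj
      obtain ⟨-, hq, -, -⟩ := hT5 j
      exact div_nonneg_of_nonpos (mul_nonpos_iff.2 (Or.inr ⟨hq, hta.le⟩)) hg.le
    have haXU : (a : ℝ) * ∑ j ∈ U, (-(co j).2.1 * t ^ a / (row a c (co j).1 (co j).2.1 (co j).2.2).eval t) ≤ P := by
      rw [hP, mul_sum]
      exact sum_le_sum hUge
    have hneg : ∑ j ∈ U, (-(co j).2.1 * t ^ a / (row a c (co j).1 (co j).2.1 (co j).2.2).eval t) =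
        -∑ j ∈ U, (co j).2.1 * t ^ a / (row a c (co j).1 (co j).2.1 (co j).2.2).eval t := by
      rw [← sum_neg_distrib]
      refine sum_congr rfl fun j _ => ?_
      ring
    rw [hneg] at haXU
    have hM : -middleSum a c co t ≤ -∑ j ∈ U, (co j).2.1 * t ^ a / (row a c (co j).1 (co j).2.1 (co j).2.2).eval t := by
      linarith
    have h1 : (a : ℝ) * ((a : ℝ) - c) * middleSum a c co t = (a : ℝ) * ((c : ℝ) - a) * (-middleSum a c co t) := by ring
    rw [h1]
    calc (a : ℝ) * ((c : ℝ) - a) * (-middleSum a c co t)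
        ≤ (a : ℝ) * ((c : ℝ) - a) * (-∑ j ∈ U, (co j).2.1 * t ^ a / (row a c (co j).1 (co j).2.1 (co j).2.2).eval t) :=
          mul_le_mul_of_nonneg_left hM (mul_pos ha' hca).le
      _ = ((c : ℝ) - a) * ((a : ℝ) * (-∑ j ∈ U, (co j).2.1 * t ^ a / (row a c (co j).1 (co j).2.1 (co j).2.2).eval t)) := by ring
      _ ≤ ((c : ℝ) - a) * P := mul_le_mul_of_nonneg_left haXU hca.le
  -- (★) `Σ φ² ≤ (c − a)·P`
  have hstar : ∑ j, φ j ^ 2 ≤ ((c : ℝ) - a) * P := hdipineq.trans hXU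
  -- `P > 0`: some row exists and no `φ_j` vanishes
  have hPpos : 0 < P := by
    have j₀ : Fin m := ⟨0, hm⟩
    have hφne : φ j₀ ≠ 0 := by
      by_cases h0 : 0 < (row a c (co j₀).1 (co j₀).2.1 (co j₀).2.2).eval t
      · have := hUpos j₀ ((hmemU j₀).2 h0)
        intro h; rw [h] at this; simp at this
      · have := hSgt j₀ ((hmemS j₀).2 (lt_of_le_of_ne (not_lt.1 h0) (hgt j₀)))
        intro h; rw [h] at this; exact absurd this (not_lt.2 ha'.le)
    have hpos2 : 0 < ∑ j, φ j ^ 2 := by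
      calc (0 : ℝ) < φ j₀ ^ 2 := by positivity
        _ ≤ ∑ j, φ j ^ 2 := single_le_sum (f := fun j => φ j ^ 2) (fun j _ => sq_nonneg (φ j)) (mem_univ j₀)
    by_contra hP0
    have : ((c : ℝ) - a) * P ≤ 0 := mul_nonpos_iff.2 (Or.inl ⟨hca.le, not_lt.1 hP0⟩)
    linarith
  -- `S` is nonempty, hence `a·#S < P`
  have hSne : S.Nonempty := by
    by_contra hSe
    rw [not_nonempty_iff_eq_empty] at hSe
    rw [hSe, sum_empty] at hSsum
    linarith
  have haS : (a : ℝ) * S.card < P := by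
    have h := sum_lt_sum_of_nonempty hSne hSgt
    rw [sum_const, nsmul_eq_mul, hSsum] at h
    linarith
  -- Cauchy–Schwarz on both sides: `m·P² ≤ #S·#U·Σφ²`
  have hCSS : P ^ 2 ≤ S.card * ∑ j ∈ S, φ j ^ 2 := by
    rw [← hSsum]
    exact sq_sum_le_card_mul_sum_sq
  have hCSU : P ^ 2 ≤ U.card * ∑ j ∈ U, φ j ^ 2 := by
    have h : (∑ j ∈ U, φ j) ^ 2 ≤ U.card * ∑ j ∈ U, φ j ^ 2 := sq_sum_le_card_mul_sum_sq
    rw [hUsum, neg_sq] at h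
    exact h
  have hScard : (0 : ℝ) < S.card := by exact_mod_cast hSne.card_pos
  have hUcard : (0 : ℝ) ≤ U.card := by exact_mod_cast Nat.zero_le _
  have hmP2 : (m : ℝ) * P ^ 2 ≤ S.card * U.card * (((c : ℝ) - a) * P) := by
    have h1 : (m : ℝ) * P ^ 2 = S.card * P ^ 2 + U.card * P ^ 2 := by rw [← hcardSU]; ring
    have h2 : (S.card : ℝ) * P ^ 2 ≤ S.card * (U.card * ∑ j ∈ U, φ j ^ 2) := mul_le_mul_of_nonneg_left hCSU hScard.le
    have h3 : (U.card : ℝ) * P ^ 2 ≤ U.card * (S.card * ∑ j ∈ S, φ j ^ 2) := mul_le_mul_of_nonneg_left hCSS hUcard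
    have h4 : (S.card : ℝ) * U.card * ∑ j, φ j ^ 2 ≤ S.card * U.card * (((c : ℝ) - a) * P) :=
      mul_le_mul_of_nonneg_left hstar (mul_nonneg hScard.le hUcard)
    rw [← hsplit2] at h4
    linarith [h1, h2, h3, h4]
  -- conclude: `m·P ≤ #S·#U·(c−a)` and `a·#S < P`
  have hmP : (m : ℝ) * P ≤ S.card * U.card * ((c : ℝ) - a) := by
    have h : (m : ℝ) * P * P ≤ S.card * U.card * ((c : ℝ) - a) * P := by
      calc (m : ℝ) * P * P = m * P ^ 2 := by ring
        _ ≤ S.card * U.card * (((c : ℝ) - a) * P) := hmP2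
        _ = S.card * U.card * ((c : ℝ) - a) * P := by ring
    exact le_of_mul_le_mul_right h hPpos
  exact ⟨hSne.card_pos, haS, hmP⟩

/-! ## The pull per `t^a` increases -/

/-- One unswitched `(+,−,−)` row: for `0 < z₁ ≤ z₂` with `g(z₁), g(z₂) > 0`, `(−z₁g′(z₁)/g(z₁))·z₂^a ≤ (−z₂g′(z₂)/g(z₂))·z₁^a`. -/
theorem pureT5_row_pull_mul_pow_le (a c : ℕ) (hac : a ≤ c) {p q s : ℝ} (hq : q ≤ 0) (hs : s ≤ 0)
    {z₁ z₂ : ℝ} (h1 : 0 < z₁) (h12 : z₁ ≤ z₂) (hg1 : 0 < (row a c p q s).eval z₁) (hg2 : 0 < (row a c p q s).eval z₂) :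
    -(z₁ * (derivative (row a c p q s)).eval z₁ / (row a c p q s).eval z₁) * z₂ ^ a ≤
      -(z₂ * (derivative (row a c p q s)).eval z₂ / (row a c p q s).eval z₂) * z₁ ^ a := by
  have h2 : 0 < z₂ := lt_of_lt_of_le h1 h12
  rw [mul_eval_derivative_row, mul_eval_derivative_row]
  have hz1a : 0 < z₁ ^ a := pow_pos h1 a
  have hz2a : 0 < z₂ ^ a := pow_pos h2 a
  -- `g` decreases: `g(z₂) ≤ g(z₁)`
  have hgle : (row a c p q s).eval z₂ ≤ (row a c p q s).eval z₁ := by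
    rw [eval_row, eval_row]
    have ha' : z₁ ^ a ≤ z₂ ^ a := pow_le_pow_left₀ h1.le h12 a
    have hc' : z₁ ^ c ≤ z₂ ^ c := pow_le_pow_left₀ h1.le h12 c
    nlinarith [mul_nonpos_iff.2 (Or.inr ⟨hq, sub_nonneg.2 ha'⟩), mul_nonpos_iff.2 (Or.inr ⟨hs, sub_nonneg.2 hc'⟩)]
  -- numerators: `N₁·z₂^a ≤ N₂·z₁^a` with `N_i = a|q|z_i^a + c|s|z_i^c ≥ 0`
  have hcpow : z₁ ^ c * z₂ ^ a ≤ z₂ ^ c * z₁ ^ a := by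
    obtain ⟨d, rfl⟩ : ∃ d, c = a + d := ⟨c - a, by omega⟩
    rw [pow_add, pow_add]
    have hd : z₁ ^ d ≤ z₂ ^ d := pow_le_pow_left₀ h1.le h12 d
    nlinarith [mul_nonneg hz1a.le hz2a.le, mul_le_mul_of_nonneg_left hd (mul_nonneg hz1a.le hz2a.le)]
  have ha0 : (0 : ℝ) ≤ a := Nat.cast_nonneg a
  have hc0 : (0 : ℝ) ≤ c := Nat.cast_nonneg c
  have hN : -((a : ℝ) * q * z₁ ^ a + (c : ℝ) * s * z₁ ^ c) * z₂ ^ a ≤ -((a : ℝ) * q * z₂ ^ a + (c : ℝ) * s * z₂ ^ c) * z₁ ^ a := by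
    nlinarith [mul_le_mul_of_nonneg_left hcpow (mul_nonneg hc0 (neg_nonneg.2 hs))]
  have hN2 : 0 ≤ -((a : ℝ) * q * z₂ ^ a + (c : ℝ) * s * z₂ ^ c) * z₁ ^ a := by
    have : (a : ℝ) * q * z₂ ^ a + (c : ℝ) * s * z₂ ^ c ≤ 0 := by
      nlinarith [mul_nonpos_iff.2 (Or.inr ⟨hq, hz2a.le⟩), mul_nonpos_iff.2 (Or.inr ⟨hs, (pow_pos h2 c).le⟩)]
    exact mul_nonneg (neg_nonneg.2 this) hz1a.le
  rw [show -(((a : ℝ) * q * z₁ ^ a + (c : ℝ) * s * z₁ ^ c) / (row a c p q s).eval z₁) * z₂ ^ a =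
      (-((a : ℝ) * q * z₁ ^ a + (c : ℝ) * s * z₁ ^ c) * z₂ ^ a) / (row a c p q s).eval z₁ by ring,
    show -(((a : ℝ) * q * z₂ ^ a + (c : ℝ) * s * z₂ ^ c) / (row a c p q s).eval z₂) * z₁ ^ a =
      (-((a : ℝ) * q * z₂ ^ a + (c : ℝ) * s * z₂ ^ c) * z₁ ^ a) / (row a c p q s).eval z₂ by ring]
  exact div_le_div₀ hN2 hN hg2 hgle

/-! ## The dip train of a window is short -/

/-- ★ **THE DIP TRAIN IS SHORT** (pure `(+,−,−)` company, `m ≥ 1`, `0 < a < c`): if `z₁ ≤ z₂` are positive critical points with no root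
of the product on `[z₁, z₂]` and `z₂` is a dip (`Φ(z₂)Φ″(z₂) ≥ 0`), then `a·m·z₂^a < (c−a)·#U·z₁^a` with `U = U(z₂)` the rows positive
on the window.  (At `z₁`: `B(z₁) = Σ_S φ_j(z₁) > a·#S`; the pull per `t^a` increases; at `z₂`: `m·B(z₂) ≤ (c−a)·#S·#U`.) -/
theorem pureT5_dip_train_short (m a c : ℕ) (hm : 0 < m) (ha : 0 < a) (hac : a < c) (co : Fin m → ℝ × ℝ × ℝ)
    (hT5 : ∀ j, 0 < (co j).1 ∧ (co j).2.1 ≤ 0 ∧ (co j).2.2 ≤ 0 ∧ ((co j).2.1 < 0 ∨ (co j).2.2 < 0))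
    {z₁ z₂ : ℝ} (h1 : 0 < z₁) (h12 : z₁ ≤ z₂)
    (hnoroot : ∀ z, z₁ ≤ z → z ≤ z₂ → (∏ j, row a c (co j).1 (co j).2.1 (co j).2.2).eval z ≠ 0)
    (hcrit₁ : (derivative (∏ j, row a c (co j).1 (co j).2.1 (co j).2.2)).eval z₁ = 0)
    (hcrit₂ : (derivative (∏ j, row a c (co j).1 (co j).2.1 (co j).2.2)).eval z₂ = 0)
    (hdip₂ : 0 ≤ (∏ j, row a c (co j).1 (co j).2.1 (co j).2.2).eval z₂ *
      (derivative (derivative (∏ j, row a c (co j).1 (co j).2.1 (co j).2.2))).eval z₂) :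
    (a : ℝ) * m * z₂ ^ a <
      ((c : ℝ) - a) * (univ.filter (fun j => 0 < (row a c (co j).1 (co j).2.1 (co j).2.2).eval z₂)).card * z₁ ^ a := by
  have h2 : 0 < z₂ := lt_of_lt_of_le h1 h12
  have ha' : (0 : ℝ) < a := by exact_mod_cast ha
  have hΦ1 := hnoroot z₁ le_rfl h12
  have hΦ2 := hnoroot z₂ h12 le_rfl
  have hg1 : ∀ j, (row a c (co j).1 (co j).2.1 (co j).2.2).eval z₁ ≠ 0 := by
    intro j h0; apply hΦ1; rw [eval_prod]; exact prod_eq_zero (mem_univ j) h0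
  have hg2 : ∀ j, (row a c (co j).1 (co j).2.1 (co j).2.2).eval z₂ ≠ 0 := by
    intro j h0; apply hΦ2; rw [eval_prod]; exact prod_eq_zero (mem_univ j) h0
  -- same signs at `z₁` and `z₂` (no root in between, rows decreasing)
  have hsame : ∀ j, 0 < (row a c (co j).1 (co j).2.1 (co j).2.2).eval z₁ ↔ 0 < (row a c (co j).1 (co j).2.1 (co j).2.2).eval z₂ := by
    intro j
    obtain ⟨-, hq, hs, hqs⟩ := hT5 j
    rcases eq_or_lt_of_le h12 with heq | hlt
    · rw [heq]
    have hdec := eval_row_lt_of_pureT5 a c ha hac (p := (co j).1) hq hs hqs h1 hlt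
    constructor
    · intro hpos
      by_contra hneg
      have hneg' : (row a c (co j).1 (co j).2.1 (co j).2.2).eval z₂ < 0 := lt_of_le_of_ne (not_lt.1 hneg) (hg2 j)
      obtain ⟨z, hz, hz0⟩ : ∃ z ∈ Set.Icc z₁ z₂, (row a c (co j).1 (co j).2.1 (co j).2.2).eval z = 0 :=
        intermediate_value_Icc' h12 (row a c (co j).1 (co j).2.1 (co j).2.2).continuousOn_aeval ⟨hneg'.le, hpos.le⟩
      apply hnoroot z hz.1 hz.2
      rw [eval_prod]
      exact prod_eq_zero (mem_univ j) hz0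
    · intro hpos
      exact hpos.trans hdec
  have hUeq : univ.filter (fun j => 0 < (row a c (co j).1 (co j).2.1 (co j).2.2).eval z₁) =
      univ.filter (fun j => 0 < (row a c (co j).1 (co j).2.1 (co j).2.2).eval z₂) :=
    filter_congr fun j _ => hsame j
  have hSeq : univ.filter (fun j => ¬ 0 < (row a c (co j).1 (co j).2.1 (co j).2.2).eval z₁) =
      univ.filter (fun j => ¬ 0 < (row a c (co j).1 (co j).2.1 (co j).2.2).eval z₂) :=
    filter_congr fun j _ => not_congr (hsame j)
  -- pull bounds at the dip `z₂`
  obtain ⟨hSpos, haS, hmP⟩ := pureT5_dip_pull_bounds m a c hm ha hac co hT5 h2 hΦ2 hcrit₂ hdip₂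
  -- the pull per `t^a` increases from `z₁` to `z₂`
  have hmono : (∑ j ∈ univ.filter (fun j => 0 < (row a c (co j).1 (co j).2.1 (co j).2.2).eval z₂),
      -(z₁ * (derivative (row a c (co j).1 (co j).2.1 (co j).2.2)).eval z₁ / (row a c (co j).1 (co j).2.1 (co j).2.2).eval z₁)) * z₂ ^ a ≤
      (∑ j ∈ univ.filter (fun j => 0 < (row a c (co j).1 (co j).2.1 (co j).2.2).eval z₂),
      -(z₂ * (derivative (row a c (co j).1 (co j).2.1 (co j).2.2)).eval z₂ / (row a c (co j).1 (co j).2.1 (co j).2.2).eval z₂)) * z₁ ^ a := by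
    rw [sum_mul, sum_mul]
    refine sum_le_sum fun j hj => ?_
    have hpos2 : 0 < (row a c (co j).1 (co j).2.1 (co j).2.2).eval z₂ := by
      rw [mem_filter] at hj; exact hj.2
    obtain ⟨-, hq, hs, -⟩ := hT5 j
    exact pureT5_row_pull_mul_pow_le a c hac.le hq hs h1 h12 ((hsame j).2 hpos2) hpos2
  -- at the critical point `z₁`: `B(z₁) = Σ_S φ_j(z₁) > a·#S`
  set φ₁ : Fin m → ℝ := fun j => z₁ * (derivative (row a c (co j).1 (co j).2.1 (co j).2.2)).eval z₁ /
    (row a c (co j).1 (co j).2.1 (co j).2.2).eval z₁ with hφ₁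
  have hsum0 : ∑ j, φ₁ j = 0 := by
    have h := eval_derivative_prod_rows m a c co hg1
    rw [hcrit₁] at h
    have hS : ∑ j, (derivative (row a c (co j).1 (co j).2.1 (co j).2.2)).eval z₁ /
        (row a c (co j).1 (co j).2.1 (co j).2.2).eval z₁ = 0 := (mul_eq_zero.1 h.symm).resolve_left hΦ1
    have e : ∑ j, φ₁ j = z₁ * ∑ j, (derivative (row a c (co j).1 (co j).2.1 (co j).2.2)).eval z₁ /
        (row a c (co j).1 (co j).2.1 (co j).2.2).eval z₁ := by
      rw [mul_sum]
      refine sum_congr rfl fun j _ => ?_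
      simp only [hφ₁]
      ring
    rw [e, hS, mul_zero]
  have hsplit : ∑ j ∈ univ.filter (fun j => 0 < (row a c (co j).1 (co j).2.1 (co j).2.2).eval z₂), φ₁ j +
      ∑ j ∈ univ.filter (fun j => ¬ 0 < (row a c (co j).1 (co j).2.1 (co j).2.2).eval z₂), φ₁ j = ∑ j, φ₁ j :=
    sum_filter_add_sum_filter_not _ _ _
  have hSgt : ∀ j ∈ univ.filter (fun j => ¬ 0 < (row a c (co j).1 (co j).2.1 (co j).2.2).eval z₂), (a : ℝ) < φ₁ j := by
    intro j hj
    rw [mem_filter] at hj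
    have hg : (row a c (co j).1 (co j).2.1 (co j).2.2).eval z₁ < 0 :=
      lt_of_le_of_ne (not_lt.1 fun h => hj.2 ((hsame j).1 h)) (hg1 j)
    obtain ⟨hp, -, hs, -⟩ := hT5 j
    have hca : (0 : ℝ) ≤ (c : ℝ) - a := by
      have : (a : ℝ) < c := by exact_mod_cast hac
      linarith
    have hγ : (co j).2.2 * z₁ ^ c ≤ 0 := mul_nonpos_iff.2 (Or.inr ⟨hs, (pow_pos h1 c).le⟩)
    simp only [hφ₁]
    rw [mul_eval_derivative_row, lt_div_iff_of_neg hg, eval_row]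
    nlinarith [mul_nonpos_iff.2 (Or.inl ⟨hca, hγ⟩), mul_pos ha' hp]
  have hB1 : (a : ℝ) * (univ.filter (fun j => ¬ 0 < (row a c (co j).1 (co j).2.1 (co j).2.2).eval z₂)).card <
      ∑ j ∈ univ.filter (fun j => 0 < (row a c (co j).1 (co j).2.1 (co j).2.2).eval z₂), -φ₁ j := by
    have hne : (univ.filter (fun j => ¬ 0 < (row a c (co j).1 (co j).2.1 (co j).2.2).eval z₂)).Nonempty :=
      card_pos.1 hSpos
    have h := sum_lt_sum_of_nonempty hne hSgt
    rw [sum_const, nsmul_eq_mul, sum_neg_distrib] at *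
    linarith
  -- chain
  have hz1a : 0 < z₁ ^ a := pow_pos h1 a
  have hz2a : 0 < z₂ ^ a := pow_pos h2 a
  have hm' : (0 : ℝ) < m := by exact_mod_cast hm
  have hS' : (0 : ℝ) < (univ.filter (fun j => ¬ 0 < (row a c (co j).1 (co j).2.1 (co j).2.2).eval z₂)).card := by
    exact_mod_cast hSpos
  set Sc : ℝ := ((univ.filter (fun j => ¬ 0 < (row a c (co j).1 (co j).2.1 (co j).2.2).eval z₂)).card : ℝ) with hSc
  set Uc : ℝ := ((univ.filter (fun j => 0 < (row a c (co j).1 (co j).2.1 (co j).2.2).eval z₂)).card : ℝ) with hUc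
  set B1 := ∑ j ∈ univ.filter (fun j => 0 < (row a c (co j).1 (co j).2.1 (co j).2.2).eval z₂), -φ₁ j with hB1def
  set B2 := ∑ j ∈ univ.filter (fun j => 0 < (row a c (co j).1 (co j).2.1 (co j).2.2).eval z₂),
      -(z₂ * (derivative (row a c (co j).1 (co j).2.1 (co j).2.2)).eval z₂ / (row a c (co j).1 (co j).2.1 (co j).2.2).eval z₂)
    with hB2def
  -- `a·Sc·z₂^a < B1·z₂^a ≤ B2·z₁^a` and `m·B2 ≤ Sc·Uc·(c−a)`
  have k1 : (a : ℝ) * Sc * z₂ ^ a < B1 * z₂ ^ a := mul_lt_mul_of_pos_right hB1 hz2a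
  have k2 : (m : ℝ) * (B2 * z₁ ^ a) ≤ Sc * Uc * ((c : ℝ) - a) * z₁ ^ a := by
    have := mul_le_mul_of_nonneg_right hmP hz1a.le
    linarith
  have k3 : Sc * ((a : ℝ) * m * z₂ ^ a) < Sc * (((c : ℝ) - a) * Uc * z₁ ^ a) := by
    nlinarith [mul_le_mul_of_nonneg_left hmono hm'.le]
  exact lt_of_mul_lt_mul_left k3 hS'.le

end ZeroChange

end Summit.ValiantsHypothesis.ValiantsHypothesis.Theorems.LacunarySymmetroidMatrixDescartes
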